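import Summits.AtomisticToContinuum.Crystallization.Theorems.ChartedZeroExcessLayeredLatticeLiouvilleZJ

/-!
# Rider ZL «PlacedSkeleton» (lens-2 g78; first brick of the (L2-C) attack, PARALLEL case)

The placed cool shadow crystal `C = placedCrystal L' w' U t` (tree YZA) IS the range of a linear chart in the sense of part ZJ:
`placedCrystal L' w' U t = range (linChart o b₁ b₂)` with origins `o m = U⁻¹ (w' m) + t` and the common in-plane basis `b₁ = U⁻¹ (L' t₁)`,
`b₂ = U⁻¹ (L' t₂)` (`t₁ t₂ = triangularVec₁ 1, triangularVec₂ 1`), and re-indexing the sheets (`o ∘ σ`) or the in-sheet coordinates by a lattice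
isometry keeps the `linChart` form.  So in the PARALLEL case of (L2-C) `CoolShadowLinearChartP` (C's layers parallel to the S-chart's sheets) the
witness chart is `Ψ' :=` this skeleton re-indexed along the registration, with wiggle `η = 0` and coverage for free (`skeleton_covers`); what remains
there is the EXACTNESS of the skeleton as a Barlow bond chart on the ball and SHEET-COMPATIBILITY — both consequences of the shadow and registration
clauses of `IsCoolShadowCrystal`, not proved here.  Pure algebra; 0 sorry; no new definitions.
-/

noncomputable section
open scoped BigOperators Classical InnerProductSpace RealInnerProductSpace
open MeasureTheory Set Metric Filter Topology
open Summit.AtomisticToContinuum.Crystallization.Theorems.ChartedPlanarOrderRigidityDoor (E3)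
open Summit.AtomisticToContinuum.Crystallization.Theorems.ChartedPlanarOrderMesoCut (LayeredHom)
open Literature.MathematicalPhysics.StatisticalMechanics (triangularVec₁ triangularVec₂)

namespace Summit.AtomisticToContinuum.Crystallization.Theorems.ChartedZeroExcessLayeredLatticeLiouville

/-- the placed skeleton, evaluated. -/
theorem linChart_placed (L' : E3 →L[ℝ] E3) (w' : ℤ → E3) (U : E3 ≃ₗᵢ[ℝ] E3) (t : E3) (y : ℤ × ℤ × ℤ) :
    linChart (fun m => U.symm (w' m) + t) (U.symm (L' (triangularVec₁ 1))) (U.symm (L' (triangularVec₂ 1))) y =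
      U.symm (L' (((y.2.1 : ℝ) • triangularVec₁ 1) + ((y.2.2 : ℝ) • triangularVec₂ 1)) + w' y.1) + t := by
  simp only [linChart, map_add, map_smul]
  abel

/-- ★ THE PLACED CRYSTAL IS THE RANGE OF ITS LINEAR SKELETON. -/
theorem placedCrystal_eq_range_linChart (L' : E3 →L[ℝ] E3) (w' : ℤ → E3) (U : E3 ≃ₗᵢ[ℝ] E3) (t : E3) :
    placedCrystal L' w' U t =
      Set.range (linChart (fun m => U.symm (w' m) + t) (U.symm (L' (triangularVec₁ 1))) (U.symm (L' (triangularVec₂ 1)))) := by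
  rw [placedCrystal_eq_image]
  ext c
  simp only [Set.mem_image, Set.mem_range, linChart_placed]
  constructor
  · rintro ⟨v, ⟨m, i, j, rfl⟩, rfl⟩
    exact ⟨(m, i, j), rfl⟩
  · rintro ⟨y, rfl⟩
    exact ⟨_, ⟨y.1, y.2.1, y.2.2, rfl⟩, rfl⟩

/-- every skeleton point is a site of the placed crystal … -/
theorem linChart_placed_mem (L' : E3 →L[ℝ] E3) (w' : ℤ → E3) (U : E3 ≃ₗᵢ[ℝ] E3) (t : E3) (y : ℤ × ℤ × ℤ) :
    linChart (fun m => U.symm (w' m) + t) (U.symm (L' (triangularVec₁ 1))) (U.symm (L' (triangularVec₂ 1))) y ∈ placedCrystal L' w' U t := by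
  rw [placedCrystal_eq_range_linChart]; exact ⟨y, rfl⟩

/-- … and every site is a skeleton point (coverage clause (c2) of (L2-C) with `RC = ∞`, before re-indexing). -/
theorem exists_linChart_placed_eq {L' : E3 →L[ℝ] E3} {w' : ℤ → E3} {U : E3 ≃ₗᵢ[ℝ] E3} {t : E3} {c : E3} (hc : c ∈ placedCrystal L' w' U t) :
    ∃ y, linChart (fun m => U.symm (w' m) + t) (U.symm (L' (triangularVec₁ 1))) (U.symm (L' (triangularVec₂ 1))) y = c := by
  rw [placedCrystal_eq_range_linChart] at hc; exact hc

/-- re-indexing the sheets keeps the linear form: `linChart (o ∘ σ) b₁ b₂ (k, q) = linChart o b₁ b₂ (σ k, q)`. -/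
theorem linChart_reindex (o : ℤ → E3) (σ : ℤ → ℤ) (b₁ b₂ : E3) (k : ℤ) (q : ℤ × ℤ) :
    linChart (o ∘ σ) b₁ b₂ (k, q) = linChart o b₁ b₂ (σ k, q) := rfl

/-- a re-indexed skeleton still covers, as soon as the re-indexing hits every sheet that is used. -/
theorem skeleton_covers {o : ℤ → E3} {b₁ b₂ : E3} {σ : ℤ → ℤ} (hσ : Function.Surjective σ) {c : E3} (hc : ∃ y, linChart o b₁ b₂ y = c) :
    ∃ y, linChart (o ∘ σ) b₁ b₂ y = c := by
  obtain ⟨⟨k, q⟩, rfl⟩ := hc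
  obtain ⟨k', rfl⟩ := hσ k
  exact ⟨(k', q), rfl⟩

/-- an in-sheet change of lattice coordinates `q ↦ a + loRot j ε q` is again a linear chart (new origins, rotated basis): the six lattice rotations
and the reflection act on the basis pair. -/
theorem linChart_loRot (o : ℤ → E3) (b₁ b₂ : E3) (a : ℤ × ℤ) (j : Fin 6) (ε : Bool) :
    ∃ (o' : ℤ → E3) (b₁' b₂' : E3), ∀ k q, linChart o b₁ b₂ (k, a + loRot j ε q) = linChart o' b₁' b₂' (k, q) := by
  refine ⟨fun k => linChart o b₁ b₂ (k, a), linChart (fun _ => 0) b₁ b₂ (0, loRot j ε (1, 0)), linChart (fun _ => 0) b₁ b₂ (0, loRot j ε (0, 1)),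
    fun k q => ?_⟩
  have hq : q = q.1 • ((1, 0) : ℤ × ℤ) + q.2 • ((0, 1) : ℤ × ℤ) := by ext <;> simp
  conv_lhs => rw [hq]
  rw [loRot_add, loRot_zsmul, loRot_zsmul]
  simp only [linChart, Prod.fst_add, Prod.snd_add, Prod.smul_fst, Prod.smul_snd, smul_eq_mul, Int.cast_add, Int.cast_mul, zero_add]
  simp only [add_smul, mul_smul, smul_add]
  abel

/-- the wiggle clause (c4) of (L2-C) holds with `η = 0` for a chart that IS a skeleton. -/
theorem wiggle_zero (o : ℤ → E3) (b₁ b₂ : E3) {η : ℝ} (hη : 0 ≤ η) (y : ℤ × ℤ × ℤ) :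
    dist (linChart o b₁ b₂ y) (linChart o b₁ b₂ y) ≤ η := by
  rw [dist_self]; exact hη

end Summit.AtomisticToContinuum.Crystallization.Theorems.ChartedZeroExcessLayeredLatticeLiouville
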